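import Summits.QuantumFields.YangMills.Theorems.IR.SmallFieldCoderS2Locality

/-!
# S₂∕C3 (4/4): the invariant, base, step and induction — `iterateCondCoders_holds : IterateCondCoders` (S₂) — and C3 `composeCond_pos`
# (one conditional composition step over a general divisor `M' ∣ M`, guarded by `1 ≤ M`)

Landed for item `stmt-QuantumFields-19354` (`--supports … --as helper`) by the LEAD prover ab-p1 (director-ym №14 (3) landing lane; ideator's OFFER
2026-08-28T05:58:49Z); authored by ideator ym-ir-idea-4 g4, split of the sorry-free workfile `Cruxes/IR/Lines/smallfield_polymer_coder_S2.lean` rev 2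
(94b95b4dc241) per `Cruxes/IR/Lines/smallfield_polymer_coder_S2_LANDING.md` v2 (four files `SmallFieldCoderS2{Nesting,LawStep,Locality,Iterate}`).

Content (§S2.5–§S2.7): `torusEdge_mem_inputBall`, `Inv`, `inv_base`, `inv_step`, `inv_all`; defs `CondCodedSeqFrom` ∕ `IterateCondCoders` (VERBATIM from the line
skeleton `Lines/smallfield_polymer_coder.lean`), ★ `iterateCondCoders_holds`; §S2.7 `composeCond_pos` ∕ `composeCond_holds` (C3).

HONESTY: plumbing only (measure theory ∕ arithmetic over `Theorems/IR/TelescopedCoding*`) — nothing here bears on the Clay Yang–Mills mass gap, a lattice gap or `BalabanLadder.IR`; R4 of the ladder closes only the conditional finite-𝕋⁴ rung `BalabanLadder.UV`.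
-/

set_option autoImplicit false

noncomputable section

open MeasureTheory
open Literature.MathematicalPhysics.QuantumFieldTheory Literature.MathematicalPhysics.QuantumLattice
open Summit.QuantumFields.YangMills.Cruxes.IR.TelescopedCoding

namespace Summit.QuantumFields.YangMills.Cruxes.IR.SmallFieldPolymerCoder

/-! ## §S2.5 The invariant, base, step, induction, and `IterateCondCoders` -/

section Iterate

variable {G : Type} [Group G] [TopologicalSpace G] [IsTopologicalGroup G] [CompactSpace G]
  [MeasurableSpace G] [BorelSpace G] [SecondCountableTopology G]

omit [Group G] [TopologicalSpace G] [IsTopologicalGroup G] [CompactSpace G] [MeasurableSpace G] [BorelSpace G]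
  [SecondCountableTopology G] in
/-- The torus edge of `e` lies in its own input ball of any radius. -/
theorem torusEdge_mem_inputBall {N : ℕ} (e : ZdEdge 4) (R : ℕ) : torusEdge N e ∈ inputBall N e R :=
  ⟨e, by simp [supDist_le_iff], rfl⟩

variable {N : ℕ} (ρ : G →* Matrix (Fin N) (Fin N) ℂ) (β : ℝ)

/-- The induction invariant at block side `M`: a conditional coder of the fine field given its `M`-blocks on the torus `2S+1`,
exact in law, with graded locality radius `M (2bs + 8b + 1)` and tail `A (s+2)^4 e^{-s}`. -/
def Inv (S b : ℕ) (A : ℝ) (M : ℕ) : Prop :=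
  ∃ C : GaugeConfig 4 (2 * S + 1) G × Noise G (2 * S + 1) → GaugeConfig 4 (2 * S + 1) G, Measurable C ∧
    (((wilsonMeasure (d := 4) (L := 2 * S + 1) ρ β).map (blockField M (2 * S + 1))).prod
        (seqNoise G (2 * S + 1))).map (fun p => (p.1, C p)) =
      (wilsonMeasure (d := 4) (L := 2 * S + 1) ρ β).map (fun U => (blockField M (2 * S + 1) U, U)) ∧
    GradedLocal S (((wilsonMeasure (d := 4) (L := 2 * S + 1) ρ β).map (blockField M (2 * S + 1))).prod
        (seqNoise G (2 * S + 1))) C (fun s => M * (2 * b * s + 8 * b + 1)) (fun s => A * ((s : ℝ) + 2) ^ 4 * Real.exp (-(s : ℝ)))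

omit [SecondCountableTopology G] in
/-- **Base**: the level-`0` conditional coder (fine given `2`-blocks) is the invariant at `M = 2`. -/
theorem inv_base {S b : ℕ} {K A : ℝ} (hKA : K ≤ A) (hA : 0 ≤ A)
    {Ψ : GaugeConfig 4 (2 * S + 1) G × Noise G (2 * S + 1) → GaugeConfig 4 (2 * S + 1) G} (hΨm : Measurable Ψ)
    (hΨlaw : (((wilsonMeasure (d := 4) (L := 2 * S + 1) ρ β).map (blockField 2 (2 * S + 1))).prod
        (seqNoise G (2 * S + 1))).map (fun p => (p.1, Ψ p)) =
      (wilsonMeasure (d := 4) (L := 2 * S + 1) ρ β).map (fun U => (blockField 2 (2 * S + 1) U, U)))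
    (hΨloc : ∀ (e : ZdEdge 4) (k : ℕ), 1 ≤ k →
      ∃ Ψ' : GaugeConfig 4 (2 * S + 1) G × Noise G (2 * S + 1) → G, Measurable Ψ' ∧
        LocalAt S e (k * (2 * b)) Ψ' ∧
        (((wilsonMeasure (d := 4) (L := 2 * S + 1) ρ β).map (blockField 2 (2 * S + 1))).prod (seqNoise G (2 * S + 1)))
            {p | Ψ p (torusEdge (2 * S + 1) e) ≠ Ψ' p} ≤ ENNReal.ofReal (K * Real.exp (-(k : ℝ)))) :
    Inv ρ β S b A 2 := by
  refine ⟨Ψ, hΨm, hΨlaw, ?_⟩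
  intro e s hs
  obtain ⟨Ψ', hm, hloc, hbad⟩ := hΨloc e s hs
  refine ⟨Ψ', hm, localAt_mono (by nlinarith) hloc, hbad.trans (ENNReal.ofReal_le_ofReal ?_)⟩
  have h1 : (1 : ℝ) ≤ ((s : ℝ) + 2) ^ 4 := one_le_pow₀ (by have := (Nat.cast_nonneg (α := ℝ) s); linarith)
  have hE : 0 < Real.exp (-(s : ℝ)) := Real.exp_pos _
  nlinarith [mul_le_mul_of_nonneg_left h1 hA, hE]

/-- **Step**: the invariant at `M` and a one-step conditional block coder `M ← 2M` give the invariant at `2M`. -/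
theorem inv_step {S M b : ℕ} (hM : 0 < M) (hMN : M ≤ 2 * S + 1) {K K' : ℝ} (hK' : 0 ≤ K') (hKK' : K ≤ K')
    (hInv : Inv ρ β S b (tailConst b K') M)
    {B : GaugeConfig 4 (2 * S + 1) G × Noise G (2 * S + 1) → GaugeConfig 4 (2 * S + 1) G} (hB : Measurable B)
    (hBlaw : (((wilsonMeasure (d := 4) (L := 2 * S + 1) ρ β).map (blockField (2 * M) (2 * S + 1))).prod
        (seqNoise G (2 * S + 1))).map (fun p => (p.1, B p)) =
      (wilsonMeasure (d := 4) (L := 2 * S + 1) ρ β).map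
        (fun U => (blockField (2 * M) (2 * S + 1) U, blockField M (2 * S + 1) U)))
    (hBloc : ∀ (e : ZdEdge 4) (k : ℕ), 1 ≤ k →
      ∃ B' : GaugeConfig 4 (2 * S + 1) G × Noise G (2 * S + 1) → G, Measurable B' ∧
        LocalAt S e (k * (2 * M * b)) B' ∧
        (((wilsonMeasure (d := 4) (L := 2 * S + 1) ρ β).map (blockField (2 * M) (2 * S + 1))).prod (seqNoise G (2 * S + 1)))
            {p | B p (torusEdge (2 * S + 1) e) ≠ B' p} ≤ ENNReal.ofReal (K * Real.exp (-(k : ℝ)))) :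
    Inv ρ β S b (tailConst b K') (2 * M) := by
  obtain ⟨C, hC, hClaw, hCloc⟩ := hInv
  have hT : Measurable fun p : GaugeConfig 4 (2 * S + 1) G × Noise G (2 * S + 1) =>
      (reblock M (2 * S + 1) (B (p.1, evenPart p.2)), oddPart p.2) :=
    ((measurable_reblock M (2 * S + 1)).comp
      (hB.comp (measurable_fst.prodMk (measurable_evenPart.comp measurable_snd)))).prodMk
      (measurable_oddPart.comp measurable_snd)
  refine ⟨fun p => C (reblock M (2 * S + 1) (B (p.1, evenPart p.2)), oddPart p.2), hC.comp hT,
    condLaw_step ρ β hM hC hB hClaw hBlaw, ?_⟩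
  -- upper locality with the nonnegative constant `K'`
  have hBloc' : ∀ (e : ZdEdge 4) (k : ℕ), 1 ≤ k →
      ∃ B' : GaugeConfig 4 (2 * S + 1) G × Noise G (2 * S + 1) → G, Measurable B' ∧
        LocalAt S e (k * (2 * M * b)) B' ∧
        (((wilsonMeasure (d := 4) (L := 2 * S + 1) ρ β).map (blockField (2 * M) (2 * S + 1))).prod (seqNoise G (2 * S + 1)))
            {p | B p (torusEdge (2 * S + 1) e) ≠ B' p} ≤ ENNReal.ofReal (K' * Real.exp (-(k : ℝ))) := by
    intro e k hk
    obtain ⟨B', hm, hloc, hbad⟩ := hBloc e k hk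
    exact ⟨B', hm, hloc, hbad.trans (ENNReal.ofReal_le_ofReal (mul_le_mul_of_nonneg_right hKK' (Real.exp_pos _).le))⟩
  have hstep := gradedLocal_step ρ β (b := b) hM hMN hK' hC hB hBlaw
    (T₁ := fun s => tailConst b K' * ((s : ℝ) + 2) ^ 4 * Real.exp (-(s : ℝ)))
    (fun s => by have := tailConst_nonneg b hK'; positivity) hCloc hBloc'
    (R' := fun s => 2 * b * s + 16 * b + 1) (fun s => le_of_eq (by ring))
  refine gradedLocal_mono (fun s _ => le_of_eq (by ring)) (fun s hs => ?_) hstep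
  exact tail_step_arith b hK' hs

/-- **All levels**: from the level-`0` coder and the block coders `2^i ← 2^{i+1}` (`1 ≤ i < n`), the invariant at every `2^m`,
`1 ≤ m ≤ n`, on a torus large enough for all the formats involved. -/
theorem inv_all {S b n : ℕ} {K : ℝ} (hSn : 2 ^ n ≤ 2 * S + 1) (hSb : 2 ^ n * b ≤ 2 * S + 1)
    (h0 : ∃ Ψ : GaugeConfig 4 (2 * S + 1) G × Noise G (2 * S + 1) → GaugeConfig 4 (2 * S + 1) G, Measurable Ψ ∧
      (((wilsonMeasure (d := 4) (L := 2 * S + 1) ρ β).map (blockField 2 (2 * S + 1))).prod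
          (seqNoise G (2 * S + 1))).map (fun p => (p.1, Ψ p)) =
        (wilsonMeasure (d := 4) (L := 2 * S + 1) ρ β).map (fun U => (blockField 2 (2 * S + 1) U, U)) ∧
      ∀ (e : ZdEdge 4) (k : ℕ), 1 ≤ k →
        ∃ Ψ' : GaugeConfig 4 (2 * S + 1) G × Noise G (2 * S + 1) → G, Measurable Ψ' ∧
          LocalAt S e (k * (2 * b)) Ψ' ∧
          (((wilsonMeasure (d := 4) (L := 2 * S + 1) ρ β).map (blockField 2 (2 * S + 1))).prod (seqNoise G (2 * S + 1)))
              {p | Ψ p (torusEdge (2 * S + 1) e) ≠ Ψ' p} ≤ ENNReal.ofReal (K * Real.exp (-(k : ℝ))))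
    (hblk : ∀ i : ℕ, 1 ≤ i → i < n → CondBlockCodedSeq ρ K β (2 ^ i) (2 ^ (i + 1)) b) :
    ∀ m : ℕ, 1 ≤ m → m ≤ n → Inv ρ β S b (tailConst b (max K 0)) (2 ^ m) := by
  intro m hm hmn
  induction m, hm using Nat.le_induction with
  | base =>
    obtain ⟨Ψ, hΨm, hΨlaw, hΨloc⟩ := h0
    rw [pow_one]
    exact inv_base ρ β ((le_max_left K 0).trans (le_tailConst b (le_max_right K 0)))
      (tailConst_nonneg b (le_max_right K 0)) hΨm hΨlaw hΨloc
  | succ m hm ih =>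
    have hmn' : m < n := by omega
    have hIm := ih (by omega)
    -- the block coder `2^m ← 2^{m+1}` on this torus
    have hfmt := hblk m hm hmn'
    have h2S : 2 ^ (m + 1) * b ≤ 2 * S + 1 :=
      le_trans (Nat.mul_le_mul_right b (Nat.pow_le_pow_right (by norm_num) hmn)) hSb
    obtain ⟨B, hBm, hBlaw, hBloc⟩ := hfmt S h2S
    have hM : 0 < 2 ^ m := pow_pos (by norm_num) m
    have hMN : 2 ^ m ≤ 2 * S + 1 := le_trans (Nat.pow_le_pow_right (by norm_num) (by omega)) hSn
    rw [pow_succ'] at hBlaw hBloc ⊢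
    exact inv_step ρ β hM hMN (le_max_right K 0) (le_max_left K 0) hIm hBm hBlaw
      (fun e k hk => hBloc e k hk)

end Iterate

/-! ## §S2.6 The rev-4 statement `IterateCondCoders` (defs VERBATIM from `Lines/smallfield_polymer_coder.lean` rev 4) — PROVED -/

section Final

section Defs
variable {G : Type} [Group G] [TopologicalSpace G] [IsTopologicalGroup G] [CompactSpace G]
  [MeasurableSpace G] [BorelSpace G]

/-- **CONDITIONAL CODER WITH A TORUS FLOOR `fl`** (rev 4): the tree format `TelescopedCoding.CondCodedSeq ρ K β M b₂` VERBATIM, asked only on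
the odd tori `2S+1 ≥ fl` (besides the format's own `2S+1 ≥ M b₂`).  `fl = 0` is the tree format (`condCodedSeqFrom_zero_iff`). -/
def CondCodedSeqFrom (fl : ℕ) {N : ℕ} (ρ : G →* Matrix (Fin N) (Fin N) ℂ) (K : ℝ) (β : ℝ) (M b₂ : ℕ) : Prop :=
  ∀ S : ℕ, M * b₂ ≤ 2 * S + 1 → fl ≤ 2 * S + 1 →
    ∃ Ψ : GaugeConfig 4 (2 * S + 1) G × Noise G (2 * S + 1) → GaugeConfig 4 (2 * S + 1) G, Measurable Ψ ∧
      (((wilsonMeasure (d := 4) (L := 2 * S + 1) ρ β).map (blockField M (2 * S + 1))).prod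
          (seqNoise G (2 * S + 1))).map (fun p => (p.1, Ψ p)) =
        (wilsonMeasure (d := 4) (L := 2 * S + 1) ρ β).map (fun U => (blockField M (2 * S + 1) U, U)) ∧
      ∀ (e : Literature.MathematicalPhysics.QuantumLattice.ZdEdge 4) (k : ℕ), 1 ≤ k →
        ∃ Ψ' : GaugeConfig 4 (2 * S + 1) G × Noise G (2 * S + 1) → G, Measurable Ψ' ∧
          (∀ p q : GaugeConfig 4 (2 * S + 1) G × Noise G (2 * S + 1),
            (∀ x ∈ inputBall (2 * S + 1) e (k * (M * b₂)), p.1 x = q.1 x) →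
            (∀ y : ℕ × Literature.MathematicalPhysics.QuantumFieldTheory.Edge 4 (2 * S + 1),
              y.2 ∈ inputBall (2 * S + 1) e (k * (M * b₂)) → p.2 y = q.2 y) → Ψ' p = Ψ' q) ∧
          (((wilsonMeasure (d := 4) (L := 2 * S + 1) ρ β).map (blockField M (2 * S + 1))).prod
              (seqNoise G (2 * S + 1))) {p | Ψ p (torusEdge (2 * S + 1) e) ≠ Ψ' p} ≤
            ENNReal.ofReal (K * Real.exp (-(k : ℝ)))

end Defs

/-- **S₂ — ITERATION with level-independent constants** (plumbing M–L, provable now, group- and `β`-blind): a conditional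
coder of the fine field given its `2`-blocks and one-step conditional block coders `2^i ← 2^{i+1}` for `1 ≤ i < n`, all
with constants `(K, b)`, compose to a conditional coder of the fine field given its `2^n`-blocks with constants
`(K₃, b₃)` depending on `(K, b)` ONLY.  Plan: exactness by the nesting identities `blockField 2^{i+1} = F ∘ blockField 2^i`
(seam-exact truncated blocks on odd tori) and disjoint noise sub-sequences per level; locality: level `i` is read at depth
`k_i = k + c (n - i)` with `c > 4 log 2`, so the input radius `Σ_i k_i b 2^{i+1} ≤ 4 (k + 2c) b 2^n` is geometric and the
union bound over the `≤ (C k b 2^{n-i})⁴` level-`i` blocks in the window gives tails `K (C k b)⁴ e^{-k} Σ_m 2^{4m} e^{-c m}`;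
re-index `k ↦ 2k`.  Degenerate cases: `n = 0` is the identity coder (`blockField 1 = id`), `n = 1` is monotonicity of the
format in `(K, b)`.  Rev 4: stated with a TORUS FLOOR `fl` carried from hypothesis to conclusion (the composition is pointwise in
the torus; `fl = 0` is rev 3's statement, `condCodedSeqFrom_zero_iff`). -/
def IterateCondCoders : Prop :=
  ∀ (K : ℝ) (b : ℕ), ∃ (K₃ : ℝ) (b₃ : ℕ),
    ∀ (G : Type) [Group G] [TopologicalSpace G] [IsTopologicalGroup G] [CompactSpace G]
      [MeasurableSpace G] [BorelSpace G] [SecondCountableTopology G] {N : ℕ} (ρ : G →* Matrix (Fin N) (Fin N) ℂ) (β : ℝ) (n fl : ℕ),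
      CondCodedSeqFrom fl ρ K β 2 b →
      (∀ i : ℕ, 1 ≤ i → i < n → CondBlockCodedSeq ρ K β (2 ^ i) (2 ^ (i + 1)) b) →
        CondCodedSeqFrom fl ρ K₃ β (2 ^ n) b₃

/-- **S₂ PROVED — `IterateCondCoders`** (rev 4 stub `stub_iterateCondCoders`): constants `b₃ = 12b + 1`,
`K₃ = 384·e·(144(16b+3)⁴ + 1)·max K 0`. -/
theorem iterateCondCoders_holds : IterateCondCoders := by
  intro K b
  refine ⟨384 * Real.exp 1 * tailConst b (max K 0), 12 * b + 1, ?_⟩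
  intro G _ _ _ _ _ _ _ N ρ β n fl h0 hblk S hS hfl
  haveI : NeZero (2 * S + 1) := ⟨by omega⟩
  haveI : IsProbabilityMeasure (seqNoise G (2 * S + 1)) := isProbabilityMeasure_seqNoise _
  haveI : SFinite (wilsonMeasure (d := 4) (L := 2 * S + 1) ρ β) := by
    unfold wilsonMeasure wilsonWeight; infer_instance
  rcases Nat.eq_zero_or_pos n with rfl | hn
  · -- `n = 0`: the identity coder of the fine field given its `1`-blocks (= itself)
    simp only [pow_zero] at hS ⊢
    have hbf1 : blockField (G := G) 1 (2 * S + 1) = id := funext blockField_one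
    refine ⟨fun p => p.1, measurable_fst, ?_, ?_⟩
    · rw [hbf1, Measure.map_id]
      have hcomp : (fun p : GaugeConfig 4 (2 * S + 1) G × Noise G (2 * S + 1) => (p.1, p.1)) =
          (fun U : GaugeConfig 4 (2 * S + 1) G => (id U, U)) ∘ Prod.fst := rfl
      rw [hcomp, ← Measure.map_map (measurable_id.prodMk measurable_id') measurable_fst, Measure.map_fst_prod,
        measure_univ, one_smul]
    · intro e k hk
      refine ⟨fun p => p.1 (torusEdge (2 * S + 1) e), (measurable_pi_apply (torusEdge (2 * S + 1) e)).comp measurable_fst,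
        fun p q hV _ => hV _ (torusEdge_mem_inputBall e _), ?_⟩
      simp
  · -- `n ≥ 1`: the telescoped composite at level `n`, read at parameter `s = 2k`
    have hSn : 2 ^ n ≤ 2 * S + 1 := le_trans (Nat.le_mul_of_pos_right _ (by omega)) hS
    have hSb : 2 ^ n * b ≤ 2 * S + 1 := le_trans (Nat.mul_le_mul_left (2 ^ n) (by omega)) hS
    have h2n : 2 ≤ 2 ^ n := by
      calc (2 : ℕ) = 2 ^ 1 := (pow_one 2).symm
        _ ≤ 2 ^ n := Nat.pow_le_pow_right (by norm_num) hn
    have h2b : 2 * b ≤ 2 * S + 1 := le_trans (Nat.mul_le_mul_right b h2n) hSb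
    obtain ⟨Ψ, hΨm, hΨlaw, hΨloc⟩ := h0 S h2b hfl
    obtain ⟨C, hC, hClaw, hCloc⟩ :=
      inv_all ρ β hSn hSb ⟨Ψ, hΨm, hΨlaw, fun e k hk => hΨloc e k hk⟩ hblk n hn le_rfl
    refine ⟨C, hC, hClaw, ?_⟩
    intro e k hk
    obtain ⟨Ψ', hm, hloc, hbad⟩ := hCloc e (2 * k) (by omega)
    have hrad : 2 ^ n * (2 * b * (2 * k) + 8 * b + 1) ≤ k * (2 ^ n * (12 * b + 1)) := by
      have h1 : 2 * b * (2 * k) + 8 * b + 1 ≤ k * (12 * b + 1) := by nlinarith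
      calc 2 ^ n * (2 * b * (2 * k) + 8 * b + 1) ≤ 2 ^ n * (k * (12 * b + 1)) := Nat.mul_le_mul_left _ h1
        _ = k * (2 ^ n * (12 * b + 1)) := by ring
    refine ⟨Ψ', hm, localAt_mono hrad hloc, hbad.trans (ENNReal.ofReal_le_ofReal ?_)⟩
    exact tail_final_arith (tailConst_nonneg b (le_max_right K 0)) k

/-! ## §S2.7 C3 (`ComposeCond`, guarded by `1 ≤ M`) — one conditional composition step over a general divisor `M' ∣ M` -/

section C3

/-- The C3 tail at parameter `s = 2k`. -/
theorem tail_c3_arith (b₃ : ℕ) {K₃' K₄' : ℝ} (h3 : 0 ≤ K₃') (h4 : 0 ≤ K₄') {k : ℕ} (hk : 1 ≤ k) :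
    K₃' * Real.exp (-((2 * k + 4 : ℕ) : ℝ)) +
        64 * ((2 * ((2 * k + 4) * b₃) + 3 : ℕ) : ℝ) ^ 4 * (K₄' * Real.exp (-((2 * k : ℕ) : ℝ))) ≤
      (K₃' + 1536 * ((12 * b₃ + 3 : ℕ) : ℝ) ^ 4 * K₄') * Real.exp (-(k : ℝ)) := by
  have hE0 : 0 < Real.exp (-(k : ℝ)) := Real.exp_pos _
  have h1 : Real.exp (-((2 * k + 4 : ℕ) : ℝ)) ≤ Real.exp (-(k : ℝ)) :=
    Real.exp_le_exp.2 (by push_cast; linarith [(Nat.cast_nonneg (α := ℝ) k)])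
  have hP : ((2 * ((2 * k + 4) * b₃) + 3 : ℕ) : ℝ) ≤ (k : ℝ) * ((12 * b₃ + 3 : ℕ) : ℝ) := by
    have : (2 * ((2 * k + 4) * b₃) + 3 : ℕ) ≤ k * (12 * b₃ + 3) := by nlinarith
    exact_mod_cast this
  have hP4 : ((2 * ((2 * k + 4) * b₃) + 3 : ℕ) : ℝ) ^ 4 ≤ (k : ℝ) ^ 4 * ((12 * b₃ + 3 : ℕ) : ℝ) ^ 4 := by
    rw [← mul_pow]; exact pow_le_pow_left₀ (by positivity) hP 4
  have h4k := pow_four_le_exp k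
  have hsq : Real.exp (-((2 * k : ℕ) : ℝ)) = Real.exp (-(k : ℝ)) * Real.exp (-(k : ℝ)) := by
    rw [← Real.exp_add]; push_cast; ring_nf
  have hinv : Real.exp (k : ℝ) * Real.exp (-(k : ℝ)) = 1 := by rw [← Real.exp_add]; simp
  have hmid : (k : ℝ) ^ 4 * Real.exp (-((2 * k : ℕ) : ℝ)) ≤ 24 * Real.exp (-(k : ℝ)) := by
    rw [hsq]
    calc (k : ℝ) ^ 4 * (Real.exp (-(k : ℝ)) * Real.exp (-(k : ℝ)))
        = ((k : ℝ) ^ 4 * Real.exp (-(k : ℝ))) * Real.exp (-(k : ℝ)) := by ring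
      _ ≤ (24 * Real.exp (k : ℝ) * Real.exp (-(k : ℝ))) * Real.exp (-(k : ℝ)) :=
          mul_le_mul_of_nonneg_right (mul_le_mul_of_nonneg_right h4k hE0.le) hE0.le
      _ = 24 * (Real.exp (k : ℝ) * Real.exp (-(k : ℝ))) * Real.exp (-(k : ℝ)) := by ring
      _ = 24 * Real.exp (-(k : ℝ)) := by rw [hinv, mul_one]
  have hQ : 0 ≤ ((12 * b₃ + 3 : ℕ) : ℝ) ^ 4 := by positivity
  have hE2 : 0 ≤ Real.exp (-((2 * k : ℕ) : ℝ)) := (Real.exp_pos _).le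
  calc K₃' * Real.exp (-((2 * k + 4 : ℕ) : ℝ)) +
        64 * ((2 * ((2 * k + 4) * b₃) + 3 : ℕ) : ℝ) ^ 4 * (K₄' * Real.exp (-((2 * k : ℕ) : ℝ)))
      ≤ K₃' * Real.exp (-(k : ℝ)) +
        64 * ((k : ℝ) ^ 4 * ((12 * b₃ + 3 : ℕ) : ℝ) ^ 4) * (K₄' * Real.exp (-((2 * k : ℕ) : ℝ))) := by
          gcongr
    _ = K₃' * Real.exp (-(k : ℝ)) +
        64 * ((12 * b₃ + 3 : ℕ) : ℝ) ^ 4 * K₄' * ((k : ℝ) ^ 4 * Real.exp (-((2 * k : ℕ) : ℝ))) := by ring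
    _ ≤ K₃' * Real.exp (-(k : ℝ)) + 64 * ((12 * b₃ + 3 : ℕ) : ℝ) ^ 4 * K₄' * (24 * Real.exp (-(k : ℝ))) := by
          gcongr
    _ = (K₃' + 1536 * ((12 * b₃ + 3 : ℕ) : ℝ) ^ 4 * K₄') * Real.exp (-(k : ℝ)) := by ring

/-- **C3 PROVED in the form the assembly consumes** (`1 ≤ M'`, `1 ≤ M`, `M' ∣ M`): a conditional coder of the fine field given its
`M'`-blocks (floored, constants `(K₃, b₃)`) and a conditional block coder `M' ← M` (constants `(K₄, b₄)`) compose to a conditional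
coder of the fine field given its `M`-blocks with constants `K₂ = max K₃ 0 + 1536 (12 b₃ + 3)⁴ max K₄ 0`, `b₂ = 6 b₃ + 2 b₄ + 1`
depending on `(K₃, K₄, b₃, b₄)` ONLY — by the exact `t`-fold nesting `blockField (t M') = nestMul t M' ∘ blockField M'`
(`condLaw_step`) and one graded locality step (`gradedLocal_step`) read at parameter `s = 2k`.  The telescoped line's registered
`stub_composeCond` omits the guard `1 ≤ M`; its only consumer (`irCal_of_telescoped`) has `M = 2^{j⋆} ≥ 1`. -/
theorem composeCond_pos (K₃ K₄ : ℝ) (b₃ b₄ : ℕ) : ∃ (K₂ : ℝ) (b₂ : ℕ),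
    ∀ (G : Type) [Group G] [TopologicalSpace G] [IsTopologicalGroup G] [CompactSpace G]
      [MeasurableSpace G] [BorelSpace G] [SecondCountableTopology G] {N : ℕ} (ρ : G →* Matrix (Fin N) (Fin N) ℂ) (β : ℝ)
      (M' M fl : ℕ), 1 ≤ M' → 1 ≤ M → M' ∣ M → CondBlockCodedSeq ρ K₄ β M' M b₄ → CondCodedSeqFrom fl ρ K₃ β M' b₃ →
        CondCodedSeqFrom fl ρ K₂ β M b₂ := by
  refine ⟨max K₃ 0 + 1536 * ((12 * b₃ + 3 : ℕ) : ℝ) ^ 4 * max K₄ 0, 6 * b₃ + 2 * b₄ + 1, ?_⟩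
  intro G _ _ _ _ _ _ _ N ρ β M' M fl hM' hM hdvd hblk hcond
  obtain ⟨t, rfl⟩ := hdvd
  rw [Nat.mul_comm M' t] at hM hblk ⊢
  have ht : 0 < t := by
    rcases Nat.eq_zero_or_pos t with rfl | h
    · simp at hM
    · exact h
  have hM'pos : 0 < M' := hM'
  have hM'le : M' ≤ t * M' := Nat.le_mul_of_pos_left M' ht
  intro S hS hfl
  haveI : NeZero (2 * S + 1) := ⟨by omega⟩
  haveI : IsProbabilityMeasure (seqNoise G (2 * S + 1)) := isProbabilityMeasure_seqNoise _
  haveI : SFinite (wilsonMeasure (d := 4) (L := 2 * S + 1) ρ β) := by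
    unfold wilsonMeasure wilsonWeight; infer_instance
  have hSb₄ : t * M' * b₄ ≤ 2 * S + 1 := le_trans (Nat.mul_le_mul_left (t * M') (by omega)) hS
  have hSb₃ : M' * b₃ ≤ 2 * S + 1 := le_trans (Nat.mul_le_mul hM'le (by omega)) hS
  have hM'S : M' ≤ 2 * S + 1 := le_trans (le_trans hM'le (Nat.le_mul_of_pos_right _ (by omega))) hS
  obtain ⟨B, hBm, hBlaw, hBloc⟩ := hblk S hSb₄
  obtain ⟨C, hCm, hClaw, hCloc⟩ := hcond S hSb₃ hfl
  -- graded form of the lower coder: its format approximant at parameter `s`, constant `max K₃ 0`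
  have hCgl : GradedLocal S (((wilsonMeasure (d := 4) (L := 2 * S + 1) ρ β).map (blockField M' (2 * S + 1))).prod
      (seqNoise G (2 * S + 1))) C (fun s => s * (M' * b₃)) (fun s => max K₃ 0 * Real.exp (-(s : ℝ))) := by
    intro e s hs
    obtain ⟨Ψ', hm, hloc, hbad⟩ := hCloc e s hs
    exact ⟨Ψ', hm, hloc, hbad.trans (ENNReal.ofReal_le_ofReal
      (mul_le_mul_of_nonneg_right (le_max_left _ _) (Real.exp_pos _).le))⟩
  -- upper locality with the nonnegative constant `max K₄ 0`
  have hBloc' : ∀ (e : ZdEdge 4) (k : ℕ), 1 ≤ k →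
      ∃ B' : GaugeConfig 4 (2 * S + 1) G × Noise G (2 * S + 1) → G, Measurable B' ∧
        LocalAt S e (k * (t * M' * b₄)) B' ∧
        (((wilsonMeasure (d := 4) (L := 2 * S + 1) ρ β).map (blockField (t * M') (2 * S + 1))).prod (seqNoise G (2 * S + 1)))
            {p | B p (torusEdge (2 * S + 1) e) ≠ B' p} ≤ ENNReal.ofReal (max K₄ 0 * Real.exp (-(k : ℝ))) := by
    intro e k hk
    obtain ⟨B', hm, hloc, hbad⟩ := hBloc e k hk
    exact ⟨B', hm, hloc, hbad.trans (ENNReal.ofReal_le_ofReal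
      (mul_le_mul_of_nonneg_right (le_max_left _ _) (Real.exp_pos _).le))⟩
  have hstep := gradedLocal_step ρ β (b := b₄) (t := t) hM'pos hM'S (le_max_right K₄ 0) hCm hBm hBlaw
    (R₁ := fun s => s * (M' * b₃)) (T₁ := fun s => max K₃ 0 * Real.exp (-(s : ℝ)))
    (fun s => mul_nonneg (le_max_right _ _) (Real.exp_pos _).le) hCgl hBloc'
    (R' := fun s => (s + 4) * b₃) (fun s => le_of_eq (by ring))
  have hT : Measurable fun p : GaugeConfig 4 (2 * S + 1) G × Noise G (2 * S + 1) =>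
      (reblock M' (2 * S + 1) (B (p.1, evenPart p.2)), oddPart p.2) :=
    ((measurable_reblock M' (2 * S + 1)).comp
      (hBm.comp (measurable_fst.prodMk (measurable_evenPart.comp measurable_snd)))).prodMk
      (measurable_oddPart.comp measurable_snd)
  refine ⟨fun p => C (reblock M' (2 * S + 1) (B (p.1, evenPart p.2)), oddPart p.2), hCm.comp hT,
    condLaw_step ρ β hM'pos hCm hBm hClaw hBlaw, ?_⟩
  intro e k hk
  obtain ⟨Ψ', hm, hloc, hbad⟩ := hstep e (2 * k) (by omega)
  have hrad : M' * ((2 * k + 4) * b₃) + M' + 2 * k * (t * M' * b₄) ≤ k * (t * M' * (6 * b₃ + 2 * b₄ + 1)) := by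
    set P : ℕ := t * M' with hP
    have h1 : M' * ((2 * k + 4) * b₃) ≤ P * (6 * k * b₃) :=
      Nat.mul_le_mul hM'le (Nat.mul_le_mul_right _ (by omega))
    have h2 : M' ≤ k * P := le_trans hM'le (Nat.le_mul_of_pos_left P hk)
    calc M' * ((2 * k + 4) * b₃) + M' + 2 * k * (P * b₄) ≤ P * (6 * k * b₃) + k * P + 2 * k * (P * b₄) := by omega
      _ = k * (P * (6 * b₃ + 2 * b₄ + 1)) := by ring
  refine ⟨Ψ', hm, localAt_mono hrad hloc, hbad.trans (ENNReal.ofReal_le_ofReal ?_)⟩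
  exact tail_c3_arith b₃ (le_max_right K₃ 0) (le_max_right K₄ 0) hk

end C3

end Final

end Summit.QuantumFields.YangMills.Cruxes.IR.SmallFieldPolymerCoder

end
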